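import Literature.Analysis.FluidPDE.LeraySchemePressure
import Literature.Analysis.FluidPDE.LeraySchemeConvergence
import Literature.Analysis.FluidPDE.NormalisedPressureLpClass
import Literature.Analysis.FluidPDE.NormalisedPressureSliceMeasurabilityLp
import Literature.Analysis.FluidPDE.RieszPressureSpaceTimeLp
import HarnessLib

/-!
# The pressures of Leray's regularised scheme: `L^{3/2}` space–time bounds and convergence

Analysis/FluidPDE theorem file (theorems only, no definitions, no named facts). Third file of the
proof that **Leray's weak solutions are suitable** (`LeraySchemeConvergence.lean`,
`LeraySchemePressure.lean`; Caffarelli–Kohn–Nirenberg 1982, Appendix; Lemarié-Rieusset 2016,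
Thm. 12.2 and Prop. 14.3; Ożański–Pooley 2018, Thm. 6.37). Along Leray's regularised scheme with its
pressures (`exists_lerayScheme_with_pressure`: classical solutions `(J_ε U, U, P)` of the drift
system with Leray's bound `‖P(t)‖₂ ≤ 9‖|J_εU||U|‖₂`) this file supplies what the passage to the
limit in the local energy equality consumes about the pressures:

* `IsLerayRegularisedScheme.ae_memLp_three_six_slice` — for a.e. `t ∈ (0, T)` the slice `U n t`
  lies in `L³ ∩ L⁶` (the dissipation is finite at a.e. time and `‖U‖₆ ≤ K‖∇U‖₂`; `L³` from the
  slab bound by Tonelli);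
* `pressure_slice_eq_polarised` — at every such time the pressure **is** the polarised Riesz
  pressure, `P n t = ¼ (p̃[J U + U] − p̃[J U − U])` (`pressure_eq_polarisedPressure`: both sides are
  `L²` solutions of the same Poisson equation, Liouville);
* `lintegral_slab_normalisedPressure_sub_rpow_le` — the bilinear Calderón–Zygmund estimate
  integrated in time: `∫∫_{I×ℝ³} |p̃[a] − p̃[c]|^{3/2} ≤ K (∫∫|a − c|³)^{1/2} (∫∫|a + c|³)^{1/2}`
  (slice-wise `exists_eLpNorm_normalisedPressure_sub_le`, Hölder, Tonelli and Cauchy–Schwarz in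
  time; Tsai 1998, proof of Lemma 2.1);
* `lintegral_slab_pressure_rpow_le` — the **uniform bound** `∫₀ᵀ∫ |P n|^{3/2} ≤ C_T` (Stein's bound
  integrated in time, `lintegral_slab_normalisedPressure_rpow_le`, and `‖J U‖₃ ≤ ‖U‖₃` with the
  uniform `L³` slab bound `lintegral_prod_cube_le`);
* `tendsto_lintegral_slab_pressure_sub` — the **strong convergence** `P n → p̃[u]` in
  `L^{3/2}((0,T) × ℝ³)` along the scheme, `u` the slice-wise limit with `U n, J U n → u` in `L³` of
  the slabs (`tendsto_lintegral_prod_sub_cube`, `tendsto_lintegral_prod_mollify_sub_cube`), by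
  `p̃[u] = ¼(p̃[u + u] − p̃[u − u])` and the integrated bilinear estimate;
* `aestronglyMeasurable_normalisedPressure_limit_slab`, `lintegral_slab_normalisedPressure_limit_lt_top`
  — the limit pressure `(t, x) ↦ p̃[u(t)](x)` is jointly measurable and in `L^{3/2}` of every slab.

(Leray 1934, §27 works with the `L²` bound only; the `L^{3/2}` control of the pressure through the
Riesz transforms is the modern route: Caffarelli–Kohn–Nirenberg 1982, Appendix; Lin 1998;
Lemarié-Rieusset 2016, Prop. 14.3; Ożański–Pooley 2018, (6.85)–(6.87).)

## Mathlib / tree search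

Tree (all used): `pressure_eq_polarisedPressure` (`LeraySchemePressure`);
`IsLerayRegularisedScheme.lintegral_prod_cube_le`, `cube_const_ne_top`,
`tendsto_lintegral_prod_sub_cube`, `tendsto_lintegral_prod_mollify_sub_cube`,
`lintegral_prod_cube_limit_lt_top`, `aestronglyMeasurable_uncurry_slab`
(`LeraySchemeConvergence`); `restrict_prod_volume_eq` (`LerayHopfTimeSlice`);
`volume_restrict_prod_univ_eq_prod` (`KatoUniquenessDual`);
`eLpNorm_six_le_frobenius_of_hasWeakGradient`
(`NSWeakStrongUniquenessProofs`); `exists_eLpNorm_normalisedPressure_sub_le`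
(`NormalisedPressureDifferenceLp`); `memLp_normalisedPressure_of_sq`, `memLp_norm_sq_of_memLp_two_mul`,
`eLpNorm_norm_mul_norm_le_two_mul` (`NormalisedPressureLpClass`);
`aestronglyMeasurable_normalisedPressure_slab`, `lintegral_slab_normalisedPressure_rpow_le`,
`exists_stronglyMeasurable_slices_ae_eq` (`NormalisedPressureSliceMeasurabilityLp`);
`ae_memLp_slice_of_memLp_slab`, `enorm_add_rpow_three_le(')`,
`lintegral_enorm_rpow_three_eq_eLpNorm_rpow`, `lintegral_enorm_rpow_threeHalves_eq_eLpNorm_rpow`,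
`volume_restrict_slab_eq_prod₃` (`RieszPressureSpaceTimeLp`); `normalisedPressure_smul`,
`normalisedPressure_zero` (`NormalisedPressure`); `FunctionSpaces.memLp_normed_convolution`,
`FunctionSpaces.eLpNorm_normed_convolution_le` (`Mollification`).
`lean search 'LerayScheme.*[Pp]ressure|pressure.*threeHalves.*slab'`: only the two scheme files
above (2026-08-15).

## References

* J. Leray, Acta Math. 63 (1934), Ch. V §§26–29. [Leray1934]
* L. Caffarelli, R. Kohn, L. Nirenberg, CPAM 35 (1982), Appendix. [CaffarelliKohnNirenberg1982]
* P. G. Lemarié-Rieusset, *The Navier–Stokes Problem in the 21st Century* (2016), Thm. 12.2,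
  Prop. 14.3. [LemarieRieusset2016]
* W. S. Ożański, B. C. Pooley, LMS Lecture Note Ser. 452 (2018), (6.85)–(6.87), Thm. 6.37.
  [OzanskiPooley2018]
* T.-P. Tsai, ARMA 143 (1998), Lemma 2.1. [Tsai1998]
* E. M. Stein, *Singular integrals* (1970), Ch. II §4.2 Thm. 3. [Stein1970]
-/

noncomputable section

open MeasureTheory TopologicalSpace Set Function Filter Metric
open scoped ENNReal NNReal Topology InnerProductSpace RealInnerProductSpace Laplacian ContDiff

namespace Literature.Analysis.FluidPDE

/-! ### Exponent bookkeeping on `ℝ³` -/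

section Exponents

/-- `1/6 + 1/3 = 1/2` (local copy of `FunctionSpaces.holderTriple_six_three_two`). [folklore] -/
private theorem holderTriple_six_three_two' : ENNReal.HolderTriple 6 3 2 := by
  refine ⟨?_⟩
  have e6 : (6 : ℝ≥0∞) = ENNReal.ofReal 6 := by simp
  have e3 : (3 : ℝ≥0∞) = ENNReal.ofReal 3 := by simp
  have e2 : (2 : ℝ≥0∞) = ENNReal.ofReal 2 := by simp
  rw [e6, e3, e2, ← ENNReal.ofReal_inv_of_pos (by norm_num), ← ENNReal.ofReal_inv_of_pos (by norm_num),
    ← ENNReal.ofReal_inv_of_pos (by norm_num), ← ENNReal.ofReal_add (by norm_num) (by norm_num)]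
  norm_num

/-- `1/6 + 1/2 = (3/2)⁻¹` (local copy of `holderTriple_six_two_threeHalves`). [folklore] -/
private theorem holderTriple_six_two_threeHalves' : ENNReal.HolderTriple 6 2 (3 / 2) := by
  refine ⟨?_⟩
  have h : ENNReal.ofReal 6⁻¹ + ENNReal.ofReal 2⁻¹ = ENNReal.ofReal (3 / 2)⁻¹ := by
    rw [← ENNReal.ofReal_add (by positivity) (by positivity)]
    norm_num
  rw [ENNReal.ofReal_inv_of_pos (by norm_num), ENNReal.ofReal_inv_of_pos (by norm_num),
    ENNReal.ofReal_inv_of_pos (by norm_num), ENNReal.ofReal_div_of_pos (by norm_num)] at h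
  simpa only [ENNReal.ofReal_ofNat] using h

/-- `2 · (3/2) = 3` in `ℝ≥0∞`. [folklore] -/
theorem two_mul_threeHalves_ennreal : (2 : ℝ≥0∞) * (3 / 2) = 3 := by
  rw [div_eq_mul_inv, mul_comm (3 : ℝ≥0∞), ← mul_assoc,
    ENNReal.mul_inv_cancel (by norm_num) (by norm_num), one_mul]

variable {f g : EuclideanSpace ℝ (Fin 3) → EuclideanSpace ℝ (Fin 3)}

/-- `|f| |g| ∈ L²` for `f ∈ L⁶`, `g ∈ L³`. [folklore] -/
theorem memLp_norm_mul_norm_two (hf : MemLp f 6 volume) (hg : MemLp g 3 volume) :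
    MemLp (fun x => ‖f x‖ * ‖g x‖) 2 volume := by
  have hT := holderTriple_six_three_two'
  have h : MemLp ((fun x => ‖f x‖) * fun x => ‖g x‖) 2 volume :=
    MemLp.mul (f := fun x => ‖g x‖) (φ := fun x => ‖f x‖) hg.norm hf.norm
  exact h

/-- `|f|² ∈ L²` for `f ∈ L³ ∩ L⁶` (i.e. `f ∈ L⁴`). [folklore] -/
theorem memLp_norm_sq_two (h3 : MemLp f 3 volume) (h6 : MemLp f 6 volume) :
    MemLp (fun x => ‖f x‖ ^ 2) 2 volume :=
  (memLp_norm_mul_norm_two h6 h3).ae_eq (Eventually.of_forall fun x => by simp only [sq])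

/-- `|f|² ∈ L^{3/2}` for `f ∈ L² ∩ L⁶`. [folklore] -/
theorem memLp_norm_sq_threeHalves_of_two_six (h2 : MemLp f 2 volume) (h6 : MemLp f 6 volume) :
    MemLp (fun x => ‖f x‖ ^ 2) (3 / 2) volume := by
  have hT := holderTriple_six_two_threeHalves'
  have h : MemLp ((fun x => ‖f x‖) * fun x => ‖f x‖) (3 / 2) volume :=
    MemLp.mul (f := fun x => ‖f x‖) (φ := fun x => ‖f x‖) h2.norm h6.norm
  exact h.ae_eq (Eventually.of_forall fun x => by simp only [Pi.mul_apply, sq])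

/-- `|f|² ∈ L^{3/2}` for `f ∈ L³`. [folklore] -/
theorem memLp_norm_sq_threeHalves_of_three (h3 : MemLp f 3 volume) :
    MemLp (fun x => ‖f x‖ ^ 2) (3 / 2) volume := by
  refine memLp_norm_sq_of_memLp_two_mul (p := 3 / 2) ?_
  rwa [two_mul_threeHalves_ennreal]

/-- `‖f‖₃^{3/2} = (∫ |f|³)^{1/2}`. [folklore] -/
theorem eLpNorm_three_rpow_threeHalves_eq (μ : Measure (EuclideanSpace ℝ (Fin 3)))
    (h : EuclideanSpace ℝ (Fin 3) → EuclideanSpace ℝ (Fin 3)) :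
    eLpNorm h 3 μ ^ (3 / 2 : ℝ) = (∫⁻ x, ‖h x‖ₑ ^ (3 : ℝ) ∂μ) ^ (1 / 2 : ℝ) := by
  rw [lintegral_enorm_rpow_three_eq_eLpNorm_rpow, ← ENNReal.rpow_mul]
  norm_num

end Exponents

/-! ### The quarter identity and the integrated bilinear estimate for `p̃` -/

section Quarter

/-- **`p̃[u] = ¼ (p̃[u + u] − p̃[u − u])`** (2-homogeneity of the normalised pressure:
`p̃[2u] = 4 p̃[u]`, `p̃[0] = 0`). [folklore] -/
theorem normalisedPressure_eq_quarter (u : EuclideanSpace ℝ (Fin 3) → EuclideanSpace ℝ (Fin 3))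
    (x : EuclideanSpace ℝ (Fin 3)) :
    normalisedPressure u x =
      4⁻¹ * (normalisedPressure (u + u) x - normalisedPressure (u - u) x) := by
  have h1 : u + u = (2 : ℝ) • u := by rw [two_smul]
  rw [h1, sub_self, normalisedPressure_smul, normalisedPressure_zero, Pi.zero_apply, sub_zero]
  ring

/-- `‖c (a − b)‖ₑ^{3/2} ≤ √2 (‖a‖ₑ^{3/2} + ‖b‖ₑ^{3/2})` for `|c| ≤ 1`. [folklore] -/
theorem enorm_mul_sub_rpow_threeHalves_le {c : ℝ} (hc : |c| ≤ 1) (a b : ℝ) :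
    ‖c * (a - b)‖ₑ ^ (3 / 2 : ℝ) ≤ 2 ^ (1 / 2 : ℝ) * (‖a‖ₑ ^ (3 / 2 : ℝ) + ‖b‖ₑ ^ (3 / 2 : ℝ)) := by
  have h1 : ‖c * (a - b)‖ₑ ≤ ‖a‖ₑ + ‖b‖ₑ := by
    rw [enorm_mul]
    calc ‖c‖ₑ * ‖a - b‖ₑ ≤ 1 * ‖a - b‖ₑ := by
          gcongr
          rw [Real.enorm_eq_ofReal_abs, ← ENNReal.ofReal_one]
          exact ENNReal.ofReal_le_ofReal hc
      _ = ‖a - b‖ₑ := one_mul _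
      _ ≤ ‖a‖ₑ + ‖b‖ₑ := enorm_sub_le
  have h2 := ENNReal.rpow_add_le_mul_rpow_add_rpow (‖a‖ₑ) (‖b‖ₑ) (by norm_num : (1 : ℝ) ≤ 3 / 2)
  have e2 : (2 : ℝ≥0∞) ^ ((3 / 2 : ℝ) - 1) = 2 ^ (1 / 2 : ℝ) := by norm_num
  rw [e2] at h2
  exact (ENNReal.rpow_le_rpow h1 (by norm_num)).trans h2

/-- **The bilinear Calderón–Zygmund estimate for `p̃`, integrated in time** (Tsai 1998, proof of
Lemma 2.1, with Tonelli and Cauchy–Schwarz in time): there is `K < ∞` such that for every time set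
`I` and all space–time fields `a, c`, a.e.-strongly measurable on `I × ℝ³` with slices in `L³(ℝ³)`
for a.e. `t ∈ I`,
`∫∫_{I×ℝ³} |p̃[a(t)](x) − p̃[c(t)](x)|^{3/2} ≤ K (∫∫_{I×ℝ³} |a − c|³)^{1/2} (∫∫_{I×ℝ³} |a + c|³)^{1/2}`.
[cite: Tsai1998, Lemma 2.1 (proof, p. 34)] [cite: Stein1970, Ch. II §4.2 Thm. 3] -/
theorem lintegral_slab_normalisedPressure_sub_rpow_le :
    ∃ K : ℝ≥0∞, K ≠ ⊤ ∧ ∀ (I : Set ℝ)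
      (a c : ℝ → EuclideanSpace ℝ (Fin 3) → EuclideanSpace ℝ (Fin 3)),
      AEStronglyMeasurable (uncurry a)
        (volume.restrict (I ×ˢ (univ : Set (EuclideanSpace ℝ (Fin 3))))) →
      AEStronglyMeasurable (uncurry c)
        (volume.restrict (I ×ˢ (univ : Set (EuclideanSpace ℝ (Fin 3))))) →
      (∀ᵐ t ∂(volume.restrict I), MemLp (a t) 3 volume) →
      (∀ᵐ t ∂(volume.restrict I), MemLp (c t) 3 volume) →
      ∫⁻ z in I ×ˢ (univ : Set (EuclideanSpace ℝ (Fin 3))),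
          ‖normalisedPressure (a z.1) z.2 - normalisedPressure (c z.1) z.2‖ₑ ^ (3 / 2 : ℝ) ≤
        K * (∫⁻ z in I ×ˢ (univ : Set (EuclideanSpace ℝ (Fin 3))),
              ‖a z.1 z.2 - c z.1 z.2‖ₑ ^ (3 : ℝ)) ^ (1 / 2 : ℝ) *
          (∫⁻ z in I ×ˢ (univ : Set (EuclideanSpace ℝ (Fin 3))),
              ‖a z.1 z.2 + c z.1 z.2‖ₑ ^ (3 : ℝ)) ^ (1 / 2 : ℝ) := by
  have hp1 : (1 : ℝ≥0∞) < 3 / 2 :=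
    (ENNReal.lt_div_iff_mul_lt (Or.inl (by norm_num)) (Or.inl (by norm_num))).2 (by norm_num)
  have hp2 : (3 / 2 : ℝ≥0∞) < ⊤ := by
    rw [ENNReal.div_eq_inv_mul]; exact ENNReal.mul_lt_top (by simp) (by simp)
  obtain ⟨C, hCt, hC⟩ := exists_eLpNorm_normalisedPressure_sub_le (p := (3 / 2 : ℝ≥0∞)) hp1 hp2
  refine ⟨C ^ (3 / 2 : ℝ), ENNReal.rpow_ne_top_of_nonneg (by norm_num) hCt, fun I a c ha hc ha3 hc3 => ?_⟩
  set μt : Measure ℝ := volume.restrict I with hμt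
  have hprod := volume_restrict_prod_univ_eq_prod (E := EuclideanSpace ℝ (Fin 3)) I
  -- strongly measurable modifications, to read off the measurability of the slices
  obtain ⟨a', ha'm, haa', haslice⟩ := exists_stronglyMeasurable_slices_ae_eq ha
  obtain ⟨c', hc'm, hcc', hcslice⟩ := exists_stronglyMeasurable_slices_ae_eq hc
  -- the slice estimate at a.e. time
  set F : ℝ → ℝ≥0∞ := fun t => (∫⁻ x, ‖a t x - c t x‖ₑ ^ (3 : ℝ)) ^ (1 / 2 : ℝ) with hF
  set G : ℝ → ℝ≥0∞ := fun t => (∫⁻ x, ‖a t x + c t x‖ₑ ^ (3 : ℝ)) ^ (1 / 2 : ℝ) with hG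
  have hslice : ∀ᵐ t ∂μt, ∫⁻ x, ‖normalisedPressure (a t) x - normalisedPressure (c t) x‖ₑ ^ (3 / 2 : ℝ) ≤
      C ^ (3 / 2 : ℝ) * (F t * G t) := by
    filter_upwards [ha3, hc3] with t hat hct
    have hdm : AEStronglyMeasurable (fun y => a t y - c t y) volume := hat.1.sub hct.1
    have hsm : AEStronglyMeasurable (fun y => a t y + c t y) volume := hat.1.add hct.1
    have h1 := hC (a t) (c t) hat.1 hct.1 (memLp_norm_sq_threeHalves_of_three hat)
      (memLp_norm_sq_threeHalves_of_three hct)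
    have h2 : eLpNorm (fun y => ‖a t y - c t y‖ * ‖a t y + c t y‖) (3 / 2) volume ≤
        eLpNorm (fun y => a t y - c t y) 3 volume * eLpNorm (fun y => a t y + c t y) 3 volume := by
      have h := eLpNorm_norm_mul_norm_le_two_mul hdm hsm (3 / 2)
      rwa [two_mul_threeHalves_ennreal] at h
    rw [lintegral_enorm_rpow_threeHalves_eq_eLpNorm_rpow]
    have e : (fun x => normalisedPressure (a t) x - normalisedPressure (c t) x) =
        fun x => normalisedPressure (a t) x - normalisedPressure (c t) x := rfl
    calc eLpNorm (fun x => normalisedPressure (a t) x - normalisedPressure (c t) x) (3 / 2 : ℝ≥0∞)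
          volume ^ (3 / 2 : ℝ)
        ≤ (C * (eLpNorm (fun y => a t y - c t y) 3 volume *
            eLpNorm (fun y => a t y + c t y) 3 volume)) ^ (3 / 2 : ℝ) :=
          ENNReal.rpow_le_rpow (h1.trans (mul_le_mul' le_rfl h2)) (by norm_num)
      _ = C ^ (3 / 2 : ℝ) * (F t * G t) := by
          rw [ENNReal.mul_rpow_of_nonneg _ _ (by norm_num), ENNReal.mul_rpow_of_nonneg _ _ (by norm_num),
            hF, hG, eLpNorm_three_rpow_threeHalves_eq, eLpNorm_three_rpow_threeHalves_eq]
  -- measurability of the slice functionals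
  have ham' : AEStronglyMeasurable (uncurry a) (μt.prod volume) := by rw [← hprod]; exact ha
  have hcm' : AEStronglyMeasurable (uncurry c) (μt.prod volume) := by rw [← hprod]; exact hc
  have hdm : AEMeasurable (fun z : ℝ × EuclideanSpace ℝ (Fin 3) => ‖a z.1 z.2 - c z.1 z.2‖ₑ ^ (3 : ℝ))
      (μt.prod volume) := (ham'.sub hcm').enorm.pow_const _
  have hsm : AEMeasurable (fun z : ℝ × EuclideanSpace ℝ (Fin 3) => ‖a z.1 z.2 + c z.1 z.2‖ₑ ^ (3 : ℝ))
      (μt.prod volume) := (ham'.add hcm').enorm.pow_const _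
  have hFm : AEMeasurable F μt := hdm.lintegral_prod_right'.pow_const _
  have hGm : AEMeasurable G μt := hsm.lintegral_prod_right'.pow_const _
  have hPm : AEStronglyMeasurable
      (fun z : ℝ × EuclideanSpace ℝ (Fin 3) => normalisedPressure (a z.1) z.2 - normalisedPressure (c z.1) z.2)
      (μt.prod volume) := by
    rw [← hprod]
    exact (aestronglyMeasurable_normalisedPressure_slab hp1 hp2 ha
        (ha3.mono fun _ ht => memLp_norm_sq_threeHalves_of_three ht)).sub
      (aestronglyMeasurable_normalisedPressure_slab hp1 hp2 hc
        (hc3.mono fun _ ht => memLp_norm_sq_threeHalves_of_three ht))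
  -- Tonelli and Cauchy–Schwarz in time
  have hCS : ∫⁻ t, F t * G t ∂μt ≤ (∫⁻ t, F t ^ (2 : ℝ) ∂μt) ^ (1 / 2 : ℝ) *
      (∫⁻ t, G t ^ (2 : ℝ) ∂μt) ^ (1 / 2 : ℝ) := by
    have h := ENNReal.lintegral_mul_le_Lp_mul_Lq μt Real.HolderConjugate.two_two hFm hGm
    simpa using h
  have hF2 : ∫⁻ t, F t ^ (2 : ℝ) ∂μt =
      ∫⁻ z in I ×ˢ (univ : Set (EuclideanSpace ℝ (Fin 3))), ‖a z.1 z.2 - c z.1 z.2‖ₑ ^ (3 : ℝ) := by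
    have e : ∀ t, F t ^ (2 : ℝ) = ∫⁻ x, ‖a t x - c t x‖ₑ ^ (3 : ℝ) := fun t => by
      rw [hF, ← ENNReal.rpow_mul]; norm_num
    simp_rw [e]
    rw [hprod, lintegral_prod _ hdm]
  have hG2 : ∫⁻ t, G t ^ (2 : ℝ) ∂μt =
      ∫⁻ z in I ×ˢ (univ : Set (EuclideanSpace ℝ (Fin 3))), ‖a z.1 z.2 + c z.1 z.2‖ₑ ^ (3 : ℝ) := by
    have e : ∀ t, G t ^ (2 : ℝ) = ∫⁻ x, ‖a t x + c t x‖ₑ ^ (3 : ℝ) := fun t => by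
      rw [hG, ← ENNReal.rpow_mul]; norm_num
    simp_rw [e]
    rw [hprod, lintegral_prod _ hsm]
  calc ∫⁻ z in I ×ˢ (univ : Set (EuclideanSpace ℝ (Fin 3))),
        ‖normalisedPressure (a z.1) z.2 - normalisedPressure (c z.1) z.2‖ₑ ^ (3 / 2 : ℝ)
      = ∫⁻ t, (∫⁻ x, ‖normalisedPressure (a t) x - normalisedPressure (c t) x‖ₑ ^ (3 / 2 : ℝ)) ∂μt := by
        rw [hprod, lintegral_prod _ (hPm.enorm.pow_const _)]
    _ ≤ ∫⁻ t, C ^ (3 / 2 : ℝ) * (F t * G t) ∂μt := lintegral_mono_ae hslice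
    _ = C ^ (3 / 2 : ℝ) * ∫⁻ t, F t * G t ∂μt := by
        have hFG : AEMeasurable (fun t => F t * G t) μt := hFm.mul hGm
        rw [lintegral_const_mul'' _ hFG]
    _ ≤ C ^ (3 / 2 : ℝ) * ((∫⁻ t, F t ^ (2 : ℝ) ∂μt) ^ (1 / 2 : ℝ) *
          (∫⁻ t, G t ^ (2 : ℝ) ∂μt) ^ (1 / 2 : ℝ)) := mul_le_mul' le_rfl hCS
    _ = _ := by rw [hF2, hG2, mul_assoc]

end Quarter

/-! ### Slices of the scheme at almost every time: `L³ ∩ L⁶` -/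

section Slices

variable {ν : ℝ} {u₀ : EuclideanSpace ℝ (Fin 3) → EuclideanSpace ℝ (Fin 3)}
  {φ : ℕ → ContDiffBump (0 : EuclideanSpace ℝ (Fin 3))}
  {U : ℕ → ℝ → EuclideanSpace ℝ (Fin 3) → EuclideanSpace ℝ (Fin 3)}

/-- **`U n t ∈ L⁶` for a.e. `t ∈ (0, T)`** along a Leray regularised scheme: the dissipation
`∫|∇U n t|²` is finite at a.e. time (`dissipation_lt_top`) and `‖U‖₆ ≤ K ‖∇U‖₂`
(`eLpNorm_six_le_frobenius_of_hasWeakGradient`). [cite: OzanskiPooley2018, (6.80)] -/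
theorem IsLerayRegularisedScheme.ae_memLp_six_slice (hS : IsLerayRegularisedScheme ν u₀ φ U) (n : ℕ)
    (T : ℝ) : ∀ᵐ t ∂(volume.restrict (Ioo 0 T)), MemLp (U n t) 6 volume := by
  have hD := hS.dissipation_lt_top n T
  have hDm : AEMeasurable (fun t => ∫⁻ x, ENNReal.ofReal (frobeniusNormSq (fderiv ℝ (U n t) x)))
      (volume.restrict (Ioo 0 T)) :=
    (hS.aemeasurable_dissipation n).mono_measure (Measure.restrict_mono Ioo_subset_Ioi_self le_rfl)
  filter_upwards [ae_lt_top' hDm hD.ne, ae_restrict_mem measurableSet_Ioo] with t ht htI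
  have h2 : MemLp (U n t) 2 volume := hS.memLp n htI.1.le
  refine ⟨h2.1, ?_⟩
  refine (eLpNorm_six_le_frobenius_of_hasWeakGradient finrank_euclideanSpace_fin_three h2
    (hS.hasWeakGradient_slice n htI.1)).trans_lt ?_
  exact ENNReal.mul_lt_top ENNReal.coe_lt_top (ENNReal.rpow_lt_top_of_nonneg (by norm_num) ht.ne)

/-- **`U n ∈ L³` of every slab `(0, T) × ℝ³`** (the uniform cube bound `lintegral_prod_cube_le`).
[cite: CaffarelliKohnNirenberg1982, §2 (2.8)–(2.9)] -/
theorem IsLerayRegularisedScheme.memLp_three_slab (hS : IsLerayRegularisedScheme ν u₀ φ U) (hν : 0 < ν)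
    (hu₀ : MemLp u₀ 2 volume) (n : ℕ) {T : ℝ} (hT : 0 ≤ T) :
    MemLp (uncurry (U n)) 3 (volume.restrict (Ioo 0 T ×ˢ (univ : Set (EuclideanSpace ℝ (Fin 3))))) := by
  refine ⟨?_, ?_⟩
  · have h := hS.aestronglyMeasurable_uncurry_slab n T
    rwa [restrict_prod_volume_eq] at h
  · have hb := hS.lintegral_prod_cube_le finrank_euclideanSpace_fin_three hν hu₀ n hT
    have h3 : eLpNorm (uncurry (U n)) 3
        (volume.restrict (Ioo 0 T ×ˢ (univ : Set (EuclideanSpace ℝ (Fin 3))))) ^ (3 : ℝ) < ⊤ := by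
      rw [← lintegral_enorm_rpow_three_eq_eLpNorm_rpow, ← restrict_prod_volume_eq]
      exact hb.trans_lt (cube_const_ne_top hu₀ T).lt_top
    exact (ENNReal.rpow_lt_top_iff_of_pos (by norm_num)).1 h3

/-- **`U n t ∈ L³` for a.e. `t ∈ (0, T)`** (Tonelli on the slab bound). [folklore] -/
theorem IsLerayRegularisedScheme.ae_memLp_three_slice (hS : IsLerayRegularisedScheme ν u₀ φ U)
    (hν : 0 < ν) (hu₀ : MemLp u₀ 2 volume) (n : ℕ) {T : ℝ} (hT : 0 ≤ T) :
    ∀ᵐ t ∂(volume.restrict (Ioo 0 T)), MemLp (U n t) 3 volume :=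
  ae_memLp_slice_of_memLp_slab (hS.memLp_three_slab hν hu₀ n hT)

/-- The a.e.-in-time slice package: `U n t ∈ L² ∩ L³ ∩ L⁶` for a.e. `t ∈ (0, T)`. [folklore] -/
theorem IsLerayRegularisedScheme.ae_memLp_three_six_slice (hS : IsLerayRegularisedScheme ν u₀ φ U)
    (hν : 0 < ν) (hu₀ : MemLp u₀ 2 volume) (n : ℕ) {T : ℝ} (hT : 0 ≤ T) :
    ∀ᵐ t ∂(volume.restrict (Ioo 0 T)), 0 < t ∧ MemLp (U n t) 3 volume ∧ MemLp (U n t) 6 volume := by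
  filter_upwards [hS.ae_memLp_three_slice hν hu₀ n hT, hS.ae_memLp_six_slice n T,
    ae_restrict_mem measurableSet_Ioo] with t h3 h6 ht
  exact ⟨ht.1, h3, h6⟩

/-- Mollified slices: `J_φ v ∈ Lq` for `v ∈ Lq`, `1 ≤ q` (Young). [folklore] -/
theorem memLp_mollify_of_memLp (ψ : ContDiffBump (0 : EuclideanSpace ℝ (Fin 3)))
    {v : EuclideanSpace ℝ (Fin 3) → EuclideanSpace ℝ (Fin 3)} {q : ℝ≥0∞} (hq : 1 ≤ q)
    (hv : MemLp v q volume) : MemLp (mollify ψ v) q volume := by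
  rw [mollify_def]
  exact FunctionSpaces.memLp_normed_convolution ψ hv hq

/-- `∫ |J_φ v|³ ≤ ∫ |v|³` (Young with a unit-mass kernel). [folklore] -/
theorem lintegral_mollify_rpow_three_le (ψ : ContDiffBump (0 : EuclideanSpace ℝ (Fin 3)))
    {v : EuclideanSpace ℝ (Fin 3) → EuclideanSpace ℝ (Fin 3)} (hv : AEStronglyMeasurable v volume) :
    ∫⁻ x, ‖mollify ψ v x‖ₑ ^ (3 : ℝ) ≤ ∫⁻ x, ‖v x‖ₑ ^ (3 : ℝ) := by
  rw [lintegral_enorm_rpow_three_eq_eLpNorm_rpow, lintegral_enorm_rpow_three_eq_eLpNorm_rpow]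
  refine ENNReal.rpow_le_rpow ?_ (by norm_num)
  rw [mollify_def]
  exact FunctionSpaces.eLpNorm_normed_convolution_le ψ hv (by norm_num)

end Slices

/-! ### The pressure slices are the polarised Riesz pressures -/

section SliceIdentity

variable {ν : ℝ} {u₀ : EuclideanSpace ℝ (Fin 3) → EuclideanSpace ℝ (Fin 3)}
  {φ : ℕ → ContDiffBump (0 : EuclideanSpace ℝ (Fin 3))}
  {U : ℕ → ℝ → EuclideanSpace ℝ (Fin 3) → EuclideanSpace ℝ (Fin 3)}
  {P : ℕ → ℝ → EuclideanSpace ℝ (Fin 3) → ℝ}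

/-- `∫ |v|² < ∞` for `v ∈ L²` (the form consumed by `pressure_eq_polarisedPressure`). [folklore] -/
theorem lintegral_enorm_sq_lt_top_of_memLp {v : EuclideanSpace ℝ (Fin 3) → EuclideanSpace ℝ (Fin 3)}
    (hv : MemLp v 2 volume) : (∫⁻ x, ‖v x‖ₑ ^ 2) < ⊤ := by
  rw [FourierNS.lintegral_enorm_sq_eq_eLpNorm_sq]
  exact ENNReal.pow_lt_top hv.eLpNorm_lt_top

/-- **The pressure of Leray's regularised solution is the polarised Riesz pressure** at every time
`t > 0` at which `U n t ∈ L³ ∩ L⁶` (so at a.e. time): with `B = J_{φ n} U n t`,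
`P n t = ¼ (p̃[B + U n t] − p̃[B − U n t])`. The two sides are `C²`, in `L²` (Leray's bound
`‖P‖₂ ≤ 9‖|B||U|‖₂` with `|B||U| ∈ L²`; Stein's bound with `B ± U ∈ L⁴`) and solve the same
Poisson equation `Δp = −div((B·∇)U)` (`laplacian_pressure_eq_of_isClassicalDriftNSSolutionOn`),
hence agree (`pressure_eq_polarisedPressure`, Liouville in `L²`). [cite: Leray1934, Ch. V §26 (5.1), §27 (5.7)] [cite: GilbargTrudinger2001, Thm. 2.1] -/
theorem pressure_slice_eq_polarised (hS : IsLerayRegularisedScheme ν u₀ φ U)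
    (hcl : ∀ n T, 0 < T →
      IsClassicalDriftNSSolutionOn (Icc 0 T) ν (fun t => mollify (φ n) (U n t)) (U n) (P n))
    (hPb : ∀ n t, 0 ≤ t → eLpNorm (P n t) 2 volume ≤
      ((9 : ℕ) : ℝ≥0∞) * eLpNorm (fun x => ‖mollify (φ n) (U n t) x‖ * ‖U n t x‖) 2 volume)
    (n : ℕ) {t : ℝ} (ht : 0 < t) (h3 : MemLp (U n t) 3 volume) (h6 : MemLp (U n t) 6 volume) :
    P n t = fun x => 4⁻¹ * (normalisedPressure (mollify (φ n) (U n t) + U n t) x -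
      normalisedPressure (mollify (φ n) (U n t) - U n t) x) := by
  have h12 : (1 : ℝ≥0∞) ≤ 2 := one_le_two
  have h13 : (1 : ℝ≥0∞) ≤ 3 := by norm_num
  have h16 : (1 : ℝ≥0∞) ≤ 6 := by norm_num
  set T : ℝ := t + 1 with hT_def
  have hT : 0 < T := by rw [hT_def]; linarith
  have htI : t ∈ Ioo 0 T := ⟨ht, by rw [hT_def]; linarith⟩
  have htS : t ∈ Icc 0 T := Ioo_subset_Icc_self htI
  have htint : t ∈ interior (Icc 0 T) := by rw [interior_Icc]; exact htI
  have hc := hcl n T hT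
  set B : EuclideanSpace ℝ (Fin 3) → EuclideanSpace ℝ (Fin 3) := mollify (φ n) (U n t) with hB
  have h2 : MemLp (U n t) 2 volume := hS.memLp n ht.le
  have hB2 : MemLp B 2 volume := memLp_mollify_of_memLp (φ n) h12 h2
  have hB3 : MemLp B 3 volume := memLp_mollify_of_memLp (φ n) h13 h3
  have hB6 : MemLp B 6 volume := memLp_mollify_of_memLp (φ n) h16 h6
  -- smoothness and the equations at time `t`
  have hu : ContDiff ℝ ∞ (U n t) := hc.smooth_velocity.contDiff_slice htS
  have hw : ContDiff ℝ ∞ B := hc.smooth_drift.contDiff_slice htS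
  have hp : ContDiff ℝ 2 (P n t) := contDiff_infty.1 (hc.smooth_pressure.contDiff_slice htS) 2
  have hdivu : VectorCalculus.IsDivFree (U n t) := hc.divFree t htS
  have hdivw : VectorCalculus.IsDivFree B := hc.divFree_drift t htS
  have hΔ : ∀ x, Δ (P n t) x = -VectorCalculus.divergence (convect B (U n t)) x := fun x =>
    laplacian_pressure_eq_of_isClassicalDriftNSSolutionOn hc htint x
  -- `P n t ∈ L²`
  have hprod : MemLp (fun x => ‖B x‖ * ‖U n t x‖) 2 volume := memLp_norm_mul_norm_two hB6 h3
  have hpL2 : MemLp (P n t) 2 volume :=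
    ⟨hp.continuous.aestronglyMeasurable, (hPb n t ht.le).trans_lt
      (ENNReal.mul_lt_top (ENNReal.natCast_ne_top 9).lt_top hprod.eLpNorm_lt_top)⟩
  -- the polarised pressures are in `L²`
  have hp1 : (1 : ℝ≥0∞) < 2 := ENNReal.one_lt_two
  have hp2 : (2 : ℝ≥0∞) < ⊤ := ENNReal.ofNat_lt_top
  have hplus : MemLp (normalisedPressure (B + U n t)) 2 volume :=
    memLp_normalisedPressure_of_sq hp1 hp2 (hB2.add h2).1 (memLp_norm_sq_two (hB3.add h3) (hB6.add h6))
  have hminus : MemLp (normalisedPressure (B - U n t)) 2 volume :=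
    memLp_normalisedPressure_of_sq hp1 hp2 (hB2.sub h2).1 (memLp_norm_sq_two (hB3.sub h3) (hB6.sub h6))
  exact pressure_eq_polarisedPressure hu hw hdivu hdivw (lintegral_enorm_sq_lt_top_of_memLp h2)
    (lintegral_enorm_sq_lt_top_of_memLp hB2) hp hpL2 hΔ hplus hminus

/-- **The slice identity at a.e. time of every slab.** [cite: Leray1934, Ch. V §27 (5.7)] -/
theorem ae_pressure_slice_eq_polarised (hS : IsLerayRegularisedScheme ν u₀ φ U) (hν : 0 < ν)
    (hu₀ : MemLp u₀ 2 volume)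
    (hcl : ∀ n T, 0 < T →
      IsClassicalDriftNSSolutionOn (Icc 0 T) ν (fun t => mollify (φ n) (U n t)) (U n) (P n))
    (hPb : ∀ n t, 0 ≤ t → eLpNorm (P n t) 2 volume ≤
      ((9 : ℕ) : ℝ≥0∞) * eLpNorm (fun x => ‖mollify (φ n) (U n t) x‖ * ‖U n t x‖) 2 volume)
    (n : ℕ) {T : ℝ} (hT : 0 ≤ T) :
    ∀ᵐ t ∂(volume.restrict (Ioo 0 T)), P n t = fun x =>
      4⁻¹ * (normalisedPressure (mollify (φ n) (U n t) + U n t) x -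
        normalisedPressure (mollify (φ n) (U n t) - U n t) x) := by
  filter_upwards [hS.ae_memLp_three_six_slice hν hu₀ n hT] with t ht
  exact pressure_slice_eq_polarised hS hcl hPb n ht.1 ht.2.1 ht.2.2

end SliceIdentity

/-! ### Generic slab statements at the exponent `3/2` -/

section SlabThreeHalves

/-- `(3/2 : ℝ≥0∞).toReal = 3/2`. [folklore] -/
theorem toReal_threeHalves : (3 / 2 : ℝ≥0∞).toReal = 3 / 2 := by
  rw [ENNReal.toReal_div]; norm_num

/-- `1 < 3/2 < ∞` in `ℝ≥0∞`. [folklore] -/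
theorem one_lt_threeHalves_and_lt_top : (1 : ℝ≥0∞) < 3 / 2 ∧ (3 / 2 : ℝ≥0∞) < ⊤ :=
  ⟨(ENNReal.lt_div_iff_mul_lt (Or.inl (by norm_num)) (Or.inl (by norm_num))).2 (by norm_num),
    by rw [ENNReal.div_eq_inv_mul]; exact ENNReal.mul_lt_top (by simp) (by simp)⟩

/-- **Joint measurability of `(t, x) ↦ p̃[u(t)](x)` on a slab** for `u` jointly measurable with
slices in `L³` at a.e. time (`aestronglyMeasurable_normalisedPressure_slab` at `p = 3/2`). [folklore] -/
theorem aestronglyMeasurable_normalisedPressure_slab_three {I : Set ℝ}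
    {u : ℝ → EuclideanSpace ℝ (Fin 3) → EuclideanSpace ℝ (Fin 3)}
    (hum : AEStronglyMeasurable (uncurry u)
      (volume.restrict (I ×ˢ (univ : Set (EuclideanSpace ℝ (Fin 3))))))
    (hu3 : ∀ᵐ t ∂(volume.restrict I), MemLp (u t) 3 volume) :
    AEStronglyMeasurable (fun z : ℝ × EuclideanSpace ℝ (Fin 3) => normalisedPressure (u z.1) z.2)
      (volume.restrict (I ×ˢ (univ : Set (EuclideanSpace ℝ (Fin 3))))) :=
  aestronglyMeasurable_normalisedPressure_slab one_lt_threeHalves_and_lt_top.1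
    one_lt_threeHalves_and_lt_top.2 hum (hu3.mono fun _ ht => memLp_norm_sq_threeHalves_of_three ht)

/-- **Stein's bound integrated in time, exponent `3/2`**: `∫∫_{I×ℝ³} |p̃[u(t)](x)|^{3/2} ≤ C^{3/2} ∫∫ |u|³`
for `u` jointly measurable with slices in `L³` at a.e. time. [cite: Stein1970, Ch. II §4.2 Thm. 3] -/
theorem lintegral_slab_normalisedPressure_rpow_threeHalves_le :
    ∃ C : ℝ≥0, ∀ (I : Set ℝ) (u : ℝ → EuclideanSpace ℝ (Fin 3) → EuclideanSpace ℝ (Fin 3)),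
      AEStronglyMeasurable (uncurry u)
        (volume.restrict (I ×ˢ (univ : Set (EuclideanSpace ℝ (Fin 3))))) →
      (∀ᵐ t ∂(volume.restrict I), MemLp (u t) 3 volume) →
      ∫⁻ z in I ×ˢ (univ : Set (EuclideanSpace ℝ (Fin 3))), ‖normalisedPressure (u z.1) z.2‖ₑ ^ (3 / 2 : ℝ) ≤
        (C : ℝ≥0∞) ^ (3 / 2 : ℝ) *
          ∫⁻ z in I ×ˢ (univ : Set (EuclideanSpace ℝ (Fin 3))), ‖u z.1 z.2‖ₑ ^ (3 : ℝ) := by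
  obtain ⟨C, hC⟩ := lintegral_slab_normalisedPressure_rpow_le (p := (3 / 2 : ℝ≥0∞))
    one_lt_threeHalves_and_lt_top.1 one_lt_threeHalves_and_lt_top.2
  refine ⟨C, fun I u hum hu3 => ?_⟩
  have h := hC I u hum (hu3.mono fun _ ht => memLp_norm_sq_threeHalves_of_three ht)
  rw [toReal_threeHalves] at h
  have e : (2 * (3 / 2) : ℝ) = 3 := by norm_num
  rw [e] at h
  exact h

end SlabThreeHalves

/-! ### The uniform `L^{3/2}` bound on slabs and the strong convergence of the pressures -/

section Slab

variable {ν : ℝ} {u₀ : EuclideanSpace ℝ (Fin 3) → EuclideanSpace ℝ (Fin 3)}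
  {φ : ℕ → ContDiffBump (0 : EuclideanSpace ℝ (Fin 3))}
  {U : ℕ → ℝ → EuclideanSpace ℝ (Fin 3) → EuclideanSpace ℝ (Fin 3)}
  {P : ℕ → ℝ → EuclideanSpace ℝ (Fin 3) → ℝ}

/-- `‖a − b‖³ ≤ 4 (‖a‖³ + ‖b‖³)`. [folklore] -/
theorem enorm_sub_rpow_three_le (a b : EuclideanSpace ℝ (Fin 3)) :
    ‖a - b‖ₑ ^ (3 : ℝ) ≤ 4 * (‖a‖ₑ ^ (3 : ℝ) + ‖b‖ₑ ^ (3 : ℝ)) := by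
  have h := enorm_add_rpow_three_le a (-b)
  rwa [← sub_eq_add_neg, enorm_neg] at h

/-- The drift `J_{φ n} U n` is a.e. strongly measurable on every slab (it is jointly smooth on
`[0, T] × ℝ³`). [folklore] -/
theorem aestronglyMeasurable_mollify_slab
    (hcl : ∀ n T, 0 < T →
      IsClassicalDriftNSSolutionOn (Icc 0 T) ν (fun t => mollify (φ n) (U n t)) (U n) (P n))
    (n : ℕ) {T : ℝ} (hT : 0 < T) :
    AEStronglyMeasurable (uncurry fun t => mollify (φ n) (U n t))
      (volume.restrict (Ioo 0 T ×ˢ (univ : Set (EuclideanSpace ℝ (Fin 3))))) :=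
  ((hcl n T hT).smooth_drift.continuousOn.mono (prod_mono Ioo_subset_Icc_self Subset.rfl)).aestronglyMeasurable
    (measurableSet_Ioo.prod MeasurableSet.univ)

/-- The pressure `P n` is a.e. strongly measurable on every slab. [folklore] -/
theorem aestronglyMeasurable_pressure_slab
    (hcl : ∀ n T, 0 < T →
      IsClassicalDriftNSSolutionOn (Icc 0 T) ν (fun t => mollify (φ n) (U n t)) (U n) (P n))
    (n : ℕ) {T : ℝ} (hT : 0 < T) :
    AEStronglyMeasurable (uncurry (P n))
      (volume.restrict (Ioo 0 T ×ˢ (univ : Set (EuclideanSpace ℝ (Fin 3))))) :=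
  ((hcl n T hT).smooth_pressure.continuousOn.mono (prod_mono Ioo_subset_Icc_self Subset.rfl)).aestronglyMeasurable
    (measurableSet_Ioo.prod MeasurableSet.univ)

/-- `∫₀ᵀ∫ |J_{φ n} U n|³ ≤ ∫₀ᵀ∫ |U n|³` (slice-wise Young and Tonelli). [folklore] -/
theorem lintegral_slab_mollify_rpow_three_le (hS : IsLerayRegularisedScheme ν u₀ φ U)
    (hcl : ∀ n T, 0 < T →
      IsClassicalDriftNSSolutionOn (Icc 0 T) ν (fun t => mollify (φ n) (U n t)) (U n) (P n))
    (n : ℕ) {T : ℝ} (hT : 0 < T) :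
    ∫⁻ z in Ioo 0 T ×ˢ (univ : Set (EuclideanSpace ℝ (Fin 3))), ‖mollify (φ n) (U n z.1) z.2‖ₑ ^ (3 : ℝ) ≤
      ∫⁻ z in Ioo 0 T ×ˢ (univ : Set (EuclideanSpace ℝ (Fin 3))), ‖U n z.1 z.2‖ₑ ^ (3 : ℝ) := by
  have hprod := volume_restrict_prod_univ_eq_prod (E := EuclideanSpace ℝ (Fin 3)) (Ioo (0 : ℝ) T)
  have hBm : AEStronglyMeasurable (uncurry fun t => mollify (φ n) (U n t))
      ((volume.restrict (Ioo (0 : ℝ) T)).prod (volume : Measure (EuclideanSpace ℝ (Fin 3)))) := by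
    rw [← hprod]; exact aestronglyMeasurable_mollify_slab hcl n hT
  have hUm : AEStronglyMeasurable (uncurry (U n))
      ((volume.restrict (Ioo (0 : ℝ) T)).prod (volume : Measure (EuclideanSpace ℝ (Fin 3)))) :=
    hS.aestronglyMeasurable_uncurry_slab n T
  have hBm' : AEMeasurable (fun z : ℝ × EuclideanSpace ℝ (Fin 3) => ‖mollify (φ n) (U n z.1) z.2‖ₑ ^ (3 : ℝ))
      ((volume.restrict (Ioo (0 : ℝ) T)).prod (volume : Measure (EuclideanSpace ℝ (Fin 3)))) :=
    hBm.enorm.pow_const _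
  have hUm' : AEMeasurable (fun z : ℝ × EuclideanSpace ℝ (Fin 3) => ‖U n z.1 z.2‖ₑ ^ (3 : ℝ))
      ((volume.restrict (Ioo (0 : ℝ) T)).prod (volume : Measure (EuclideanSpace ℝ (Fin 3)))) :=
    hUm.enorm.pow_const _
  rw [hprod, lintegral_prod _ hBm', lintegral_prod _ hUm']
  refine lintegral_mono_ae ?_
  filter_upwards [ae_restrict_mem measurableSet_Ioo] with t ht
  exact lintegral_mollify_rpow_three_le (φ n) (hS.memLp n ht.1.le).1

/-- **The uniform `L^{3/2}` bound for the pressures of Leray's scheme on slabs**: for every `T > 0`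
there is `C_T < ∞` with `∫₀ᵀ∫ |P n|^{3/2} ≤ C_T` for all `n` (the slice identity
`P n = ¼(p̃[JU + U] − p̃[JU − U])` a.e., Stein's bound integrated in time, `|a ± b|³ ≤ 4(|a|³ + |b|³)`,
`‖JU‖₃ ≤ ‖U‖₃` and the uniform slab bound `∫₀ᵀ∫|U n|³ ≤ M`; Ożański–Pooley 2018, (6.85)–(6.87);
Lemarié-Rieusset 2016, Prop. 14.3). [cite: OzanskiPooley2018, (6.85)–(6.87)] [cite: LemarieRieusset2016, Prop. 14.3] -/
theorem lintegral_slab_pressure_rpow_le (hS : IsLerayRegularisedScheme ν u₀ φ U) (hν : 0 < ν)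
    (hu₀ : MemLp u₀ 2 volume)
    (hcl : ∀ n T, 0 < T →
      IsClassicalDriftNSSolutionOn (Icc 0 T) ν (fun t => mollify (φ n) (U n t)) (U n) (P n))
    (hPb : ∀ n t, 0 ≤ t → eLpNorm (P n t) 2 volume ≤
      ((9 : ℕ) : ℝ≥0∞) * eLpNorm (fun x => ‖mollify (φ n) (U n t) x‖ * ‖U n t x‖) 2 volume)
    {T : ℝ} (hT : 0 < T) :
    ∃ Cp : ℝ≥0∞, Cp ≠ ⊤ ∧ ∀ n,
      ∫⁻ z in Ioo 0 T ×ˢ (univ : Set (EuclideanSpace ℝ (Fin 3))), ‖P n z.1 z.2‖ₑ ^ (3 / 2 : ℝ) ≤ Cp := by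
  obtain ⟨C, hC⟩ := lintegral_slab_normalisedPressure_rpow_threeHalves_le
  -- the uniform cube bound
  set M : ℝ≥0∞ := ENNReal.ofReal T * eLpNorm u₀ 2 volume ^ 2 +
    (eLpNorm u₀ 2 volume ^ 2) ^ (2 / 3 : ℝ) *
      ((SNormLESNormFDerivOfEqConst (EuclideanSpace ℝ (Fin 3)) (volume : Measure (EuclideanSpace ℝ (Fin 3))) 2 : ℝ≥0∞) ^ 2 *
        ENNReal.ofReal (VectorCalculus.kineticEnergy u₀ / ν)) with hM
  have hMt : M ≠ ⊤ := cube_const_ne_top hu₀ T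
  have hUM : ∀ n, ∫⁻ z in Ioo 0 T ×ˢ (univ : Set (EuclideanSpace ℝ (Fin 3))), ‖U n z.1 z.2‖ₑ ^ (3 : ℝ) ≤ M := by
    intro n
    rw [← restrict_prod_volume_eq]
    exact hS.lintegral_prod_cube_le finrank_euclideanSpace_fin_three hν hu₀ n hT.le
  set Cp : ℝ≥0∞ := 2 ^ (1 / 2 : ℝ) * (2 * ((C : ℝ≥0∞) ^ (3 / 2 : ℝ) * (4 * (M + M)))) with hCp
  have hCpt : Cp ≠ ⊤ := by
    rw [hCp]
    refine ENNReal.mul_ne_top (ENNReal.rpow_ne_top_of_nonneg (by norm_num) ENNReal.ofNat_ne_top)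
      (ENNReal.mul_ne_top ENNReal.ofNat_ne_top (ENNReal.mul_ne_top
        (ENNReal.rpow_ne_top_of_nonneg (by norm_num) ENNReal.coe_ne_top)
        (ENNReal.mul_ne_top ENNReal.ofNat_ne_top (ENNReal.add_ne_top.2 ⟨hMt, hMt⟩))))
  refine ⟨Cp, hCpt, fun n => ?_⟩
  set S : Set (ℝ × EuclideanSpace ℝ (Fin 3)) := Ioo 0 T ×ˢ (univ : Set (EuclideanSpace ℝ (Fin 3))) with hSdef
  set μs : Measure (ℝ × EuclideanSpace ℝ (Fin 3)) := volume.restrict S with hμs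
  have hprod : μs = (volume.restrict (Ioo (0 : ℝ) T)).prod (volume : Measure (EuclideanSpace ℝ (Fin 3))) :=
    volume_restrict_prod_univ_eq_prod (Ioo (0 : ℝ) T)
  -- the two polarised fields
  set B : ℝ → EuclideanSpace ℝ (Fin 3) → EuclideanSpace ℝ (Fin 3) := fun t => mollify (φ n) (U n t) with hB
  set a : ℝ → EuclideanSpace ℝ (Fin 3) → EuclideanSpace ℝ (Fin 3) := fun t x => B t x + U n t x with ha
  set a' : ℝ → EuclideanSpace ℝ (Fin 3) → EuclideanSpace ℝ (Fin 3) := fun t x => B t x - U n t x with ha'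
  have hBm : AEStronglyMeasurable (uncurry B) μs := aestronglyMeasurable_mollify_slab hcl n hT
  have hUm : AEStronglyMeasurable (uncurry (U n)) μs := (hS.memLp_three_slab hν hu₀ n hT.le).1
  have ham : AEStronglyMeasurable (uncurry a) μs := hBm.add hUm
  have ha'm : AEStronglyMeasurable (uncurry a') μs := hBm.sub hUm
  have hslices := hS.ae_memLp_three_six_slice hν hu₀ n hT.le
  have h13 : (1 : ℝ≥0∞) ≤ 3 := by norm_num
  have ha3 : ∀ᵐ t ∂(volume.restrict (Ioo 0 T)), MemLp (a t) 3 volume := by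
    filter_upwards [hslices] with t ht
    exact (memLp_mollify_of_memLp (φ n) h13 ht.2.1).add ht.2.1
  have ha'3 : ∀ᵐ t ∂(volume.restrict (Ioo 0 T)), MemLp (a' t) 3 volume := by
    filter_upwards [hslices] with t ht
    exact (memLp_mollify_of_memLp (φ n) h13 ht.2.1).sub ht.2.1
  -- the slice identity, a.e. on the slab
  have hslice := ae_pressure_slice_eq_polarised hS hν hu₀ hcl hPb n hT.le
  have hbad : μs ({t | ¬ P n t = fun x => 4⁻¹ * (normalisedPressure (mollify (φ n) (U n t) + U n t) x -
      normalisedPressure (mollify (φ n) (U n t) - U n t) x)} ×ˢ (univ : Set (EuclideanSpace ℝ (Fin 3)))) = 0 := by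
    rw [hprod, Measure.prod_prod, ae_iff.1 hslice, zero_mul]
  have hae : ∀ᵐ z ∂μs, ‖P n z.1 z.2‖ₑ ^ (3 / 2 : ℝ) =
      ‖4⁻¹ * (normalisedPressure (a z.1) z.2 - normalisedPressure (a' z.1) z.2)‖ₑ ^ (3 / 2 : ℝ) := by
    filter_upwards [measure_eq_zero_iff_ae_notMem.1 hbad] with z hz
    have h : P n z.1 = fun x => 4⁻¹ * (normalisedPressure (mollify (φ n) (U n z.1) + U n z.1) x -
        normalisedPressure (mollify (φ n) (U n z.1) - U n z.1) x) := by
      by_contra h'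
      exact hz ⟨h', mem_univ _⟩
    rw [h]
    rfl
  have hB3m : AEMeasurable (fun z : ℝ × EuclideanSpace ℝ (Fin 3) => ‖B z.1 z.2‖ₑ ^ (3 : ℝ)) μs :=
    hBm.enorm.pow_const _
  -- Stein's bound for the two polarised fields
  have hSa : ∫⁻ z in S, ‖normalisedPressure (a z.1) z.2‖ₑ ^ (3 / 2 : ℝ) ≤
      (C : ℝ≥0∞) ^ (3 / 2 : ℝ) * (4 * (M + M)) := by
    refine (hC (Ioo 0 T) a ham ha3).trans (mul_le_mul' le_rfl ?_)
    calc ∫⁻ z in S, ‖a z.1 z.2‖ₑ ^ (3 : ℝ)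
        ≤ ∫⁻ z in S, 4 * (‖B z.1 z.2‖ₑ ^ (3 : ℝ) + ‖U n z.1 z.2‖ₑ ^ (3 : ℝ)) :=
          lintegral_mono fun z => enorm_add_rpow_three_le _ _
      _ = 4 * ((∫⁻ z in S, ‖B z.1 z.2‖ₑ ^ (3 : ℝ)) + ∫⁻ z in S, ‖U n z.1 z.2‖ₑ ^ (3 : ℝ)) := by
          rw [lintegral_const_mul' _ _ ENNReal.ofNat_ne_top, lintegral_add_left' hB3m]
      _ ≤ 4 * (M + M) := by
          gcongr
          · exact (lintegral_slab_mollify_rpow_three_le hS hcl n hT).trans (hUM n)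
          · exact hUM n
  have hSa' : ∫⁻ z in S, ‖normalisedPressure (a' z.1) z.2‖ₑ ^ (3 / 2 : ℝ) ≤
      (C : ℝ≥0∞) ^ (3 / 2 : ℝ) * (4 * (M + M)) := by
    refine (hC (Ioo 0 T) a' ha'm ha'3).trans (mul_le_mul' le_rfl ?_)
    calc ∫⁻ z in S, ‖a' z.1 z.2‖ₑ ^ (3 : ℝ)
        ≤ ∫⁻ z in S, 4 * (‖B z.1 z.2‖ₑ ^ (3 : ℝ) + ‖U n z.1 z.2‖ₑ ^ (3 : ℝ)) :=
          lintegral_mono fun z => enorm_sub_rpow_three_le _ _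
      _ = 4 * ((∫⁻ z in S, ‖B z.1 z.2‖ₑ ^ (3 : ℝ)) + ∫⁻ z in S, ‖U n z.1 z.2‖ₑ ^ (3 : ℝ)) := by
          rw [lintegral_const_mul' _ _ ENNReal.ofNat_ne_top, lintegral_add_left' hB3m]
      _ ≤ 4 * (M + M) := by
          gcongr
          · exact (lintegral_slab_mollify_rpow_three_le hS hcl n hT).trans (hUM n)
          · exact hUM n
  -- assemble
  have hPam : AEMeasurable (fun z : ℝ × EuclideanSpace ℝ (Fin 3) =>
      ‖normalisedPressure (a z.1) z.2‖ₑ ^ (3 / 2 : ℝ)) μs :=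
    (aestronglyMeasurable_normalisedPressure_slab_three ham ha3).enorm.pow_const _
  calc ∫⁻ z in S, ‖P n z.1 z.2‖ₑ ^ (3 / 2 : ℝ)
      = ∫⁻ z in S, ‖4⁻¹ * (normalisedPressure (a z.1) z.2 - normalisedPressure (a' z.1) z.2)‖ₑ ^ (3 / 2 : ℝ) :=
        lintegral_congr_ae hae
    _ ≤ ∫⁻ z in S, 2 ^ (1 / 2 : ℝ) * (‖normalisedPressure (a z.1) z.2‖ₑ ^ (3 / 2 : ℝ) +
          ‖normalisedPressure (a' z.1) z.2‖ₑ ^ (3 / 2 : ℝ)) :=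
        lintegral_mono fun z => enorm_mul_sub_rpow_threeHalves_le (by norm_num) _ _
    _ = 2 ^ (1 / 2 : ℝ) * ((∫⁻ z in S, ‖normalisedPressure (a z.1) z.2‖ₑ ^ (3 / 2 : ℝ)) +
          ∫⁻ z in S, ‖normalisedPressure (a' z.1) z.2‖ₑ ^ (3 / 2 : ℝ)) := by
        rw [lintegral_const_mul' _ _ (ENNReal.rpow_ne_top_of_nonneg (by norm_num) ENNReal.ofNat_ne_top),
          lintegral_add_left' hPam]
    _ ≤ 2 ^ (1 / 2 : ℝ) * ((C : ℝ≥0∞) ^ (3 / 2 : ℝ) * (4 * (M + M)) +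
          (C : ℝ≥0∞) ^ (3 / 2 : ℝ) * (4 * (M + M))) := by gcongr
    _ = Cp := by rw [hCp, two_mul]

end Slab

/-! ### Strong convergence of the pressures on slabs -/

section Convergence

variable {ν : ℝ} {u₀ : EuclideanSpace ℝ (Fin 3) → EuclideanSpace ℝ (Fin 3)}
  {φ : ℕ → ContDiffBump (0 : EuclideanSpace ℝ (Fin 3))}
  {U : ℕ → ℝ → EuclideanSpace ℝ (Fin 3) → EuclideanSpace ℝ (Fin 3)}
  {P : ℕ → ℝ → EuclideanSpace ℝ (Fin 3) → ℝ}

/-- **Strong convergence of the pressures of Leray's scheme**: along a Leray regularised scheme with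
its pressures and slice-wise limit `u` with `U n → u` strongly in `L²` at a.e. time (the situation
of `IsLerayRegularisedScheme.exists_subseq_limit_package`), for every `T > 0`,
`∫₀ᵀ∫ |P n − p̃[u(t)]|^{3/2} → 0`: by the slice identity and `p̃[u] = ¼(p̃[u+u] − p̃[u−u])`,
`P n − p̃[u] = ¼((p̃[JU+U] − p̃[u+u]) − (p̃[JU−U] − p̃[0]))`, and the integrated bilinear estimate
bounds the two differences by `K (∫∫|a−c|³)^{1/2} (∫∫|a+c|³)^{1/2}` with `∫∫|a − c|³ → 0`
(`U n, J U n → u` in `L³` of the slab) and `∫∫|a + c|³` bounded (Ożański–Pooley 2018, (6.87):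
"`p_{εₙ} → p` in `L^{3/2}`"; Lemarié-Rieusset 2016, Prop. 14.3).
[cite: OzanskiPooley2018, (6.87) and Thm. 6.37 (proof)] [cite: LemarieRieusset2016, Prop. 14.3] -/
theorem tendsto_lintegral_slab_pressure_sub (hS : IsLerayRegularisedScheme ν u₀ φ U) (hν : 0 < ν)
    (hu₀ : MemLp u₀ 2 volume)
    (hcl : ∀ n T, 0 < T →
      IsClassicalDriftNSSolutionOn (Icc 0 T) ν (fun t => mollify (φ n) (U n t)) (U n) (P n))
    (hPb : ∀ n t, 0 ≤ t → eLpNorm (P n t) 2 volume ≤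
      ((9 : ℕ) : ℝ≥0∞) * eLpNorm (fun x => ‖mollify (φ n) (U n t) x‖ * ‖U n t x‖) 2 volume)
    {u : ℝ → EuclideanSpace ℝ (Fin 3) → EuclideanSpace ℝ (Fin 3)} (hW : IsSliceWeakLimit U u₀ u)
    (hmeas : AEStronglyMeasurable (uncurry u)
      ((volume.restrict (Ioi (0 : ℝ))).prod (volume : Measure (EuclideanSpace ℝ (Fin 3)))))
    (hae : ∀ᵐ t ∂(volume.restrict (Ioi (0 : ℝ))),
      Tendsto (fun n => eLpNorm (U n t - u t) 2 volume) atTop (𝓝 0))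
    {T : ℝ} (hT : 0 < T) :
    Tendsto (fun n => ∫⁻ z in Ioo 0 T ×ˢ (univ : Set (EuclideanSpace ℝ (Fin 3))),
      ‖P n z.1 z.2 - normalisedPressure (u z.1) z.2‖ₑ ^ (3 / 2 : ℝ)) atTop (𝓝 0) := by
  obtain ⟨K, hKt, hK⟩ := lintegral_slab_normalisedPressure_sub_rpow_le
  have hE := finrank_euclideanSpace_fin_three
  set S : Set (ℝ × EuclideanSpace ℝ (Fin 3)) := Ioo 0 T ×ˢ (univ : Set (EuclideanSpace ℝ (Fin 3))) with hSdef
  set μs : Measure (ℝ × EuclideanSpace ℝ (Fin 3)) := volume.restrict S with hμs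
  have hprod : μs = (volume.restrict (Ioo (0 : ℝ) T)).prod (volume : Measure (EuclideanSpace ℝ (Fin 3))) :=
    volume_restrict_prod_univ_eq_prod (Ioo (0 : ℝ) T)
  have h13 : (1 : ℝ≥0∞) ≤ 3 := by norm_num
  -- the limit field on the slab
  have hum : AEStronglyMeasurable (uncurry u) μs := by
    rw [hprod]; exact hmeas.mono_measure (prod_restrict_Ioo_le_prod_restrict_Ioi T)
  have hMu : ∫⁻ z, ‖u z.1 z.2‖ₑ ^ (3 : ℝ) ∂μs < ⊤ := by
    rw [hprod]; exact hS.lintegral_prod_cube_limit_lt_top hE hν hu₀ hW hmeas hae hT.le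
  have hu3slab : MemLp (uncurry u) 3 μs := by
    refine ⟨hum, ?_⟩
    have h : eLpNorm (uncurry u) 3 μs ^ (3 : ℝ) < ⊤ := by
      rw [← lintegral_enorm_rpow_three_eq_eLpNorm_rpow]; exact hMu
    exact (ENNReal.rpow_lt_top_iff_of_pos (by norm_num)).1 h
  have hu3 : ∀ᵐ t ∂(volume.restrict (Ioo 0 T)), MemLp (u t) 3 volume :=
    ae_memLp_slice_of_memLp_slab hu3slab
  have hu3m : AEMeasurable (fun z : ℝ × EuclideanSpace ℝ (Fin 3) => ‖u z.1 z.2‖ₑ ^ (3 : ℝ)) μs :=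
    hum.enorm.pow_const _
  -- the doubled limit field `c = u + u` and its cube integral
  set c : ℝ → EuclideanSpace ℝ (Fin 3) → EuclideanSpace ℝ (Fin 3) := fun t x => u t x + u t x with hc
  have hcm : AEStronglyMeasurable (uncurry c) μs := hum.add hum
  have hc3 : ∀ᵐ t ∂(volume.restrict (Ioo 0 T)), MemLp (c t) 3 volume := by
    filter_upwards [hu3] with t ht
    exact ht.add ht
  set Cc : ℝ≥0∞ := ∫⁻ z, ‖c z.1 z.2‖ₑ ^ (3 : ℝ) ∂μs with hCc
  have hCcle : Cc ≤ 4 * ((∫⁻ z, ‖u z.1 z.2‖ₑ ^ (3 : ℝ) ∂μs) + ∫⁻ z, ‖u z.1 z.2‖ₑ ^ (3 : ℝ) ∂μs) := by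
    calc Cc ≤ ∫⁻ z, 4 * (‖u z.1 z.2‖ₑ ^ (3 : ℝ) + ‖u z.1 z.2‖ₑ ^ (3 : ℝ)) ∂μs :=
          lintegral_mono fun z => enorm_add_rpow_three_le _ _
      _ = _ := by rw [lintegral_const_mul' _ _ ENNReal.ofNat_ne_top, lintegral_add_left' hu3m]
  have hCct : Cc ≠ ⊤ := ne_top_of_le_ne_top
    (ENNReal.mul_ne_top ENNReal.ofNat_ne_top (ENNReal.add_ne_top.2 ⟨hMu.ne, hMu.ne⟩)) hCcle
  -- the two strong convergences on the slab
  have hxU : Tendsto (fun n => ∫⁻ z, ‖U n z.1 z.2 - u z.1 z.2‖ₑ ^ (3 : ℝ) ∂μs) atTop (𝓝 0) := by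
    rw [hprod]; exact hS.tendsto_lintegral_prod_sub_cube hE hν hu₀ hW hmeas hae hT.le
  have hxB : Tendsto (fun n => ∫⁻ z, ‖mollify (φ n) (U n z.1) z.2 - u z.1 z.2‖ₑ ^ (3 : ℝ) ∂μs)
      atTop (𝓝 0) := by
    rw [hprod]; exact hS.tendsto_lintegral_prod_mollify_sub_cube hE hν hu₀ hW hmeas hae hT.le
  set s : ℕ → ℝ≥0∞ := fun n => (∫⁻ z, ‖mollify (φ n) (U n z.1) z.2 - u z.1 z.2‖ₑ ^ (3 : ℝ) ∂μs) +
    ∫⁻ z, ‖U n z.1 z.2 - u z.1 z.2‖ₑ ^ (3 : ℝ) ∂μs with hs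
  have hs0 : Tendsto s atTop (𝓝 0) := by
    have h := hxB.add hxU
    rw [add_zero] at h
    exact h
  -- ### the bound for one index
  set D : ℝ≥0∞ := (4 * (4 * 1 + 8 * Cc)) ^ (1 / 2 : ℝ) with hD
  have hDt : D ≠ ⊤ := ENNReal.rpow_ne_top_of_nonneg (by norm_num)
    (ENNReal.mul_ne_top ENNReal.ofNat_ne_top (ENNReal.add_ne_top.2
      ⟨ENNReal.mul_ne_top ENNReal.ofNat_ne_top ENNReal.one_ne_top, ENNReal.mul_ne_top ENNReal.ofNat_ne_top hCct⟩))
  have hbound : ∀ n, s n ≤ 1 →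
      ∫⁻ z in S, ‖P n z.1 z.2 - normalisedPressure (u z.1) z.2‖ₑ ^ (3 / 2 : ℝ) ≤
        2 ^ (1 / 2 : ℝ) * (2 * (K * ((4 * s n) ^ (1 / 2 : ℝ) * D))) := by
    intro n hn
    -- the fields
    set B : ℝ → EuclideanSpace ℝ (Fin 3) → EuclideanSpace ℝ (Fin 3) := fun t => mollify (φ n) (U n t) with hB
    set a : ℝ → EuclideanSpace ℝ (Fin 3) → EuclideanSpace ℝ (Fin 3) := fun t x => B t x + U n t x with ha
    set a' : ℝ → EuclideanSpace ℝ (Fin 3) → EuclideanSpace ℝ (Fin 3) := fun t x => B t x - U n t x with ha'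
    have hBm : AEStronglyMeasurable (uncurry B) μs := aestronglyMeasurable_mollify_slab hcl n hT
    have hUm : AEStronglyMeasurable (uncurry (U n)) μs := (hS.memLp_three_slab hν hu₀ n hT.le).1
    have ham : AEStronglyMeasurable (uncurry a) μs := hBm.add hUm
    have ha'm : AEStronglyMeasurable (uncurry a') μs := hBm.sub hUm
    have hslices := hS.ae_memLp_three_six_slice hν hu₀ n hT.le
    have ha3 : ∀ᵐ t ∂(volume.restrict (Ioo 0 T)), MemLp (a t) 3 volume := by
      filter_upwards [hslices] with t ht
      exact (memLp_mollify_of_memLp (φ n) h13 ht.2.1).add ht.2.1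
    have ha'3 : ∀ᵐ t ∂(volume.restrict (Ioo 0 T)), MemLp (a' t) 3 volume := by
      filter_upwards [hslices] with t ht
      exact (memLp_mollify_of_memLp (φ n) h13 ht.2.1).sub ht.2.1
    have h0m : AEStronglyMeasurable (uncurry fun (_ : ℝ) => (0 : EuclideanSpace ℝ (Fin 3) → EuclideanSpace ℝ (Fin 3))) μs :=
      aestronglyMeasurable_const
    have h03 : ∀ᵐ t ∂(volume.restrict (Ioo 0 T)),
        MemLp ((fun (_ : ℝ) => (0 : EuclideanSpace ℝ (Fin 3) → EuclideanSpace ℝ (Fin 3))) t) 3 volume :=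
      Eventually.of_forall fun _ => MemLp.zero
    -- the pointwise identity, a.e. on the slab
    have hslice := ae_pressure_slice_eq_polarised hS hν hu₀ hcl hPb n hT.le
    have hbad : μs ({t | ¬ P n t = fun x => 4⁻¹ * (normalisedPressure (mollify (φ n) (U n t) + U n t) x -
        normalisedPressure (mollify (φ n) (U n t) - U n t) x)} ×ˢ (univ : Set (EuclideanSpace ℝ (Fin 3)))) = 0 := by
      rw [hprod, Measure.prod_prod, ae_iff.1 hslice, zero_mul]
    have hae' : ∀ᵐ z ∂μs, ‖P n z.1 z.2 - normalisedPressure (u z.1) z.2‖ₑ ^ (3 / 2 : ℝ) =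
        ‖4⁻¹ * ((normalisedPressure (a z.1) z.2 - normalisedPressure (c z.1) z.2) -
          (normalisedPressure (a' z.1) z.2 - normalisedPressure (0 : EuclideanSpace ℝ (Fin 3) → EuclideanSpace ℝ (Fin 3)) z.2))‖ₑ ^ (3 / 2 : ℝ) := by
      filter_upwards [measure_eq_zero_iff_ae_notMem.1 hbad] with z hz
      have h : P n z.1 = fun x => 4⁻¹ * (normalisedPressure (mollify (φ n) (U n z.1) + U n z.1) x -
          normalisedPressure (mollify (φ n) (U n z.1) - U n z.1) x) := by
        by_contra h'
        exact hz ⟨h', mem_univ _⟩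
      have hq := normalisedPressure_eq_quarter (u z.1) z.2
      rw [sub_self] at hq
      have e : P n z.1 z.2 - normalisedPressure (u z.1) z.2 =
          4⁻¹ * ((normalisedPressure (a z.1) z.2 - normalisedPressure (c z.1) z.2) -
            (normalisedPressure (a' z.1) z.2 - normalisedPressure (0 : EuclideanSpace ℝ (Fin 3) → EuclideanSpace ℝ (Fin 3)) z.2)) := by
        rw [h, hq]
        change 4⁻¹ * (normalisedPressure (a z.1) z.2 - normalisedPressure (a' z.1) z.2) -
          4⁻¹ * (normalisedPressure (c z.1) z.2 - normalisedPressure 0 z.2) = _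
        ring
      rw [e]
    -- the first difference: `a − c = (B − u) + (U − u)`
    have h1 := hK (Ioo 0 T) a c ham hcm ha3 hc3
    have hac : ∫⁻ z in S, ‖a z.1 z.2 - c z.1 z.2‖ₑ ^ (3 : ℝ) ≤ 4 * s n := by
      have e : ∀ z : ℝ × EuclideanSpace ℝ (Fin 3), a z.1 z.2 - c z.1 z.2 =
          (B z.1 z.2 - u z.1 z.2) + (U n z.1 z.2 - u z.1 z.2) := fun z => by
        simp only [ha, hc]; abel
      simp_rw [e]
      calc ∫⁻ z in S, ‖(B z.1 z.2 - u z.1 z.2) + (U n z.1 z.2 - u z.1 z.2)‖ₑ ^ (3 : ℝ)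
          ≤ ∫⁻ z in S, 4 * (‖B z.1 z.2 - u z.1 z.2‖ₑ ^ (3 : ℝ) + ‖U n z.1 z.2 - u z.1 z.2‖ₑ ^ (3 : ℝ)) :=
            lintegral_mono fun z => enorm_add_rpow_three_le _ _
        _ = 4 * s n := by
            have hm : AEMeasurable (fun z : ℝ × EuclideanSpace ℝ (Fin 3) =>
                ‖B z.1 z.2 - u z.1 z.2‖ₑ ^ (3 : ℝ)) μs := (hBm.sub hum).enorm.pow_const _
            rw [lintegral_const_mul' _ _ ENNReal.ofNat_ne_top, lintegral_add_left' hm]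
    have hapc : ∫⁻ z in S, ‖a z.1 z.2 + c z.1 z.2‖ₑ ^ (3 : ℝ) ≤ 4 * (4 * 1 + 8 * Cc) := by
      calc ∫⁻ z in S, ‖a z.1 z.2 + c z.1 z.2‖ₑ ^ (3 : ℝ)
          ≤ ∫⁻ z in S, 4 * (‖a z.1 z.2 - c z.1 z.2‖ₑ ^ (3 : ℝ) + 8 * ‖c z.1 z.2‖ₑ ^ (3 : ℝ)) :=
            lintegral_mono fun z => enorm_add_rpow_three_le' _ _
        _ = 4 * ((∫⁻ z in S, ‖a z.1 z.2 - c z.1 z.2‖ₑ ^ (3 : ℝ)) + 8 * Cc) := by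
            have hm : AEMeasurable (fun z : ℝ × EuclideanSpace ℝ (Fin 3) =>
                ‖a z.1 z.2 - c z.1 z.2‖ₑ ^ (3 : ℝ)) μs := (ham.sub hcm).enorm.pow_const _
            rw [lintegral_const_mul' _ _ ENNReal.ofNat_ne_top, lintegral_add_left' hm,
              lintegral_const_mul' _ _ ENNReal.ofNat_ne_top]
        _ ≤ 4 * (4 * 1 + 8 * Cc) := by
            gcongr
            exact hac.trans (mul_le_mul' le_rfl hn)
    have hT1 : ∫⁻ z in S, ‖normalisedPressure (a z.1) z.2 - normalisedPressure (c z.1) z.2‖ₑ ^ (3 / 2 : ℝ) ≤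
        K * ((4 * s n) ^ (1 / 2 : ℝ) * D) := by
      refine h1.trans ?_
      rw [mul_assoc]
      exact mul_le_mul' le_rfl (mul_le_mul' (ENNReal.rpow_le_rpow hac (by norm_num))
        (ENNReal.rpow_le_rpow hapc (by norm_num)))
    -- the second difference: `a' − 0 = a' = (B − u) − (U − u)`
    have h2 := hK (Ioo 0 T) a' (fun _ => 0) ha'm h0m ha'3 h03
    have ha'b : ∫⁻ z in S, ‖a' z.1 z.2‖ₑ ^ (3 : ℝ) ≤ 4 * s n := by
      have e : ∀ z : ℝ × EuclideanSpace ℝ (Fin 3), a' z.1 z.2 =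
          (B z.1 z.2 - u z.1 z.2) - (U n z.1 z.2 - u z.1 z.2) := fun z => by
        simp only [ha']; abel
      simp_rw [e]
      calc ∫⁻ z in S, ‖(B z.1 z.2 - u z.1 z.2) - (U n z.1 z.2 - u z.1 z.2)‖ₑ ^ (3 : ℝ)
          ≤ ∫⁻ z in S, 4 * (‖B z.1 z.2 - u z.1 z.2‖ₑ ^ (3 : ℝ) + ‖U n z.1 z.2 - u z.1 z.2‖ₑ ^ (3 : ℝ)) :=
            lintegral_mono fun z => enorm_sub_rpow_three_le _ _
        _ = 4 * s n := by
            have hm : AEMeasurable (fun z : ℝ × EuclideanSpace ℝ (Fin 3) =>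
                ‖B z.1 z.2 - u z.1 z.2‖ₑ ^ (3 : ℝ)) μs := (hBm.sub hum).enorm.pow_const _
            rw [lintegral_const_mul' _ _ ENNReal.ofNat_ne_top, lintegral_add_left' hm]
    have hT2 : ∫⁻ z in S, ‖normalisedPressure (a' z.1) z.2 -
        normalisedPressure (0 : EuclideanSpace ℝ (Fin 3) → EuclideanSpace ℝ (Fin 3)) z.2‖ₑ ^ (3 / 2 : ℝ) ≤
        K * ((4 * s n) ^ (1 / 2 : ℝ) * D) := by
      have e1 : ∫⁻ z in S, ‖a' z.1 z.2 - (fun _ => (0 : EuclideanSpace ℝ (Fin 3) → EuclideanSpace ℝ (Fin 3))) z.1 z.2‖ₑ ^ (3 : ℝ) =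
          ∫⁻ z in S, ‖a' z.1 z.2‖ₑ ^ (3 : ℝ) :=
        lintegral_congr fun z => by simp only [Pi.zero_apply, sub_zero]
      have e2 : ∫⁻ z in S, ‖a' z.1 z.2 + (fun _ => (0 : EuclideanSpace ℝ (Fin 3) → EuclideanSpace ℝ (Fin 3))) z.1 z.2‖ₑ ^ (3 : ℝ) =
          ∫⁻ z in S, ‖a' z.1 z.2‖ₑ ^ (3 : ℝ) :=
        lintegral_congr fun z => by simp only [Pi.zero_apply, add_zero]
      rw [e1, e2] at h2
      refine h2.trans ?_
      rw [mul_assoc]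
      gcongr K * (?_ * ?_)
      · exact ENNReal.rpow_le_rpow ha'b (by norm_num)
      · refine ENNReal.rpow_le_rpow (ha'b.trans ?_) (by norm_num)
        calc 4 * s n ≤ 4 * 1 := mul_le_mul' le_rfl hn
          _ ≤ 4 * 1 + 8 * Cc := le_self_add
          _ ≤ 4 * (4 * 1 + 8 * Cc) := le_mul_of_one_le_left zero_le (by norm_num)
    -- assemble
    have hm1 : AEMeasurable (fun z : ℝ × EuclideanSpace ℝ (Fin 3) =>
        ‖normalisedPressure (a z.1) z.2 - normalisedPressure (c z.1) z.2‖ₑ ^ (3 / 2 : ℝ)) μs :=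
      ((aestronglyMeasurable_normalisedPressure_slab_three ham ha3).sub
        (aestronglyMeasurable_normalisedPressure_slab_three hcm hc3)).enorm.pow_const _
    calc ∫⁻ z in S, ‖P n z.1 z.2 - normalisedPressure (u z.1) z.2‖ₑ ^ (3 / 2 : ℝ)
        = ∫⁻ z in S, ‖4⁻¹ * ((normalisedPressure (a z.1) z.2 - normalisedPressure (c z.1) z.2) -
            (normalisedPressure (a' z.1) z.2 -
              normalisedPressure (0 : EuclideanSpace ℝ (Fin 3) → EuclideanSpace ℝ (Fin 3)) z.2))‖ₑ ^ (3 / 2 : ℝ) :=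
          lintegral_congr_ae hae'
      _ ≤ ∫⁻ z in S, 2 ^ (1 / 2 : ℝ) *
            (‖normalisedPressure (a z.1) z.2 - normalisedPressure (c z.1) z.2‖ₑ ^ (3 / 2 : ℝ) +
              ‖normalisedPressure (a' z.1) z.2 -
                normalisedPressure (0 : EuclideanSpace ℝ (Fin 3) → EuclideanSpace ℝ (Fin 3)) z.2‖ₑ ^ (3 / 2 : ℝ)) :=
          lintegral_mono fun z => enorm_mul_sub_rpow_threeHalves_le (by norm_num) _ _
      _ = 2 ^ (1 / 2 : ℝ) *
            ((∫⁻ z in S, ‖normalisedPressure (a z.1) z.2 - normalisedPressure (c z.1) z.2‖ₑ ^ (3 / 2 : ℝ)) +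
              ∫⁻ z in S, ‖normalisedPressure (a' z.1) z.2 -
                normalisedPressure (0 : EuclideanSpace ℝ (Fin 3) → EuclideanSpace ℝ (Fin 3)) z.2‖ₑ ^ (3 / 2 : ℝ)) := by
          rw [lintegral_const_mul' _ _ (ENNReal.rpow_ne_top_of_nonneg (by norm_num) ENNReal.ofNat_ne_top),
            lintegral_add_left' hm1]
      _ ≤ 2 ^ (1 / 2 : ℝ) * (K * ((4 * s n) ^ (1 / 2 : ℝ) * D) + K * ((4 * s n) ^ (1 / 2 : ℝ) * D)) := by
          gcongr
      _ = 2 ^ (1 / 2 : ℝ) * (2 * (K * ((4 * s n) ^ (1 / 2 : ℝ) * D))) := by rw [two_mul]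
  -- ### the limit of the bound
  have hlim : Tendsto (fun n => 2 ^ (1 / 2 : ℝ) * (2 * (K * ((4 * s n) ^ (1 / 2 : ℝ) * D)))) atTop (𝓝 0) := by
    have h4 : Tendsto (fun n => 4 * s n) atTop (𝓝 0) := by
      simpa using ENNReal.Tendsto.const_mul hs0 (Or.inr ENNReal.ofNat_ne_top)
    have hr : Tendsto (fun n => (4 * s n) ^ (1 / 2 : ℝ)) atTop (𝓝 0) := by
      have h := ((ENNReal.continuous_rpow_const (y := (1 / 2 : ℝ))).tendsto 0).comp h4
      rwa [ENNReal.zero_rpow_of_pos (by norm_num)] at h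
    have hrD : Tendsto (fun n => (4 * s n) ^ (1 / 2 : ℝ) * D) atTop (𝓝 0) := by
      simpa using ENNReal.Tendsto.mul_const hr (Or.inr hDt)
    have hK' : Tendsto (fun n => K * ((4 * s n) ^ (1 / 2 : ℝ) * D)) atTop (𝓝 0) := by
      simpa using ENNReal.Tendsto.const_mul hrD (Or.inr hKt)
    have h2' : Tendsto (fun n => 2 * (K * ((4 * s n) ^ (1 / 2 : ℝ) * D))) atTop (𝓝 0) := by
      simpa using ENNReal.Tendsto.const_mul hK' (Or.inr ENNReal.ofNat_ne_top)
    simpa using ENNReal.Tendsto.const_mul h2'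
      (Or.inr (ENNReal.rpow_ne_top_of_nonneg (by norm_num) ENNReal.ofNat_ne_top))
  -- ### squeeze
  have hev : ∀ᶠ n in atTop, s n ≤ 1 := hs0.eventually (Iic_mem_nhds zero_lt_one)
  refine tendsto_of_tendsto_of_tendsto_of_le_of_le' tendsto_const_nhds hlim
    (Eventually.of_forall fun n => zero_le) ?_
  filter_upwards [hev] with n hn
  exact hbound n hn

end Convergence

end Literature.Analysis.FluidPDE

end
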